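import Mathlib
import Summits.Ventures.PercRepro.PuncturedLYMMixT2Q1Table1

/-!
# PercRepro — (SP) FOR `2` PAIRWISE DISJOINT TRIPLES AND `1` PAIRWISE DISJOINT QUADRUPLES AT LEVEL `4`: POSITIVITY OF THE DENOMINATORS (1)
(p10, gen 41)

`den > 0`, `Pc > 0` for `n ≥ 10`; `Yc > 0` for `n ≥ 5`.  Nothing here asserts (SP).
-/

namespace PercRepro.PuncturedLYM.Split.TypeLift.MixT2Q1

/-- `den > 0` for `n ≥ 10`. -/
theorem den_pos (n : ℚ) (hn : 10 ≤ n) : 0 < den n := by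
  obtain ⟨n', hn', rfl⟩ : ∃ n', 0 ≤ n' ∧ n = 10 + n' := ⟨n - 10, by linarith, by ring⟩
  have h : den (10 + n') = 15552 * n' ^ 13 + 1732752 * n' ^ 12 + 88942320 * n' ^ 11 + 2783792772 * n' ^ 10 + 59250465900 * n' ^ 9 + 905227378848 * n' ^ 8 + 10209112272888 * n' ^ 7 + 86019346463028 * n' ^ 6 + 541252032904140 * n' ^ 5 + 2510844646063704 * n' ^ 4 + 8343340970809632 * n' ^ 3 + 18798095235562944 * n' ^ 2 + 25728438000365568 * n' + 16149218331018240 := by unfold den; ring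
  rw [h]; positivity

/-- `Yc > 0` for `n ≥ 5`. -/
theorem Yc_pos (n : ℚ) (hn : 5 ≤ n) : 0 < Yc n := by
  obtain ⟨n', hn', rfl⟩ : ∃ n', 0 ≤ n' ∧ n = 5 + n' := ⟨n - 5, by linarith, by ring⟩
  have h : Yc (5 + n') = (1 / 120) * n' ^ 5 + (1 / 8) * n' ^ 4 + (17 / 24) * n' ^ 3 + (15 / 8) * n' ^ 2 + (137 / 60) * n' + 1 := by unfold Yc; ring
  rw [h]; positivity

/-- `Pc > 0` for `n ≥ 10`. -/
theorem Pc_pos (n : ℚ) (hn : 10 ≤ n) : 0 < Pc n := by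
  obtain ⟨n', hn', rfl⟩ : ∃ n', 0 ≤ n' ∧ n = 10 + n' := ⟨n - 10, by linarith, by ring⟩
  have h : Pc (10 + n') = (1 / 24) * n' ^ 4 + (17 / 12) * n' ^ 3 + (431 / 24) * n' ^ 2 + (1183 / 12) * n' + 195 := by unfold Pc; ring
  rw [h]; positivity

end PercRepro.PuncturedLYM.Split.TypeLift.MixT2Q1
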